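import Literature.GroupTheory.CombinatorialGroupTheory.RandomSclFreeGroupProofs
import HarnessLib

/-!
# Random rigidity of scl (Calegari–Walker 2013): proofs, part 24 — comb configurations:
regularity forces admissibility

D. Calegari, A. Walker, *Random rigidity in the free group*, Geom. Topol. 17 (2013)
[CalegariWalker2013], Def. 4.10–4.11 and §4.6. A *comb configuration* of complexity `d` in a
word records an arc `[s, s + Σλ)` cut into consecutive pieces `b_i` of lengths `λ_i`
(`i = 0..d`), occurrences `D_i = [t_i, t_i + λ_i)` of the inverses `B_i`, and flanks of lengths
`κ_e` (`e = 1..d`) realising the third edges: `vg (t_i + j) = vg (s + Λ_i + λ_i − 1 − j)⁻¹` and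
`vg (t_e + λ_e + j) = vg (t_{e−1} − 1 − j)⁻¹`. If the arc is `g`-regular (its subwords of
length `g` are pairwise distinct and distinct from the inverses of such subwords, Def. 4.11), two
occurrence windows `D_i`, `D_j` meet in fewer than `g` points, and so do `D_i` and the arc: the
configuration is *admissible*, which is what the overlap accounting of part 23 needs.
All data are `ℕ`-indexed (`Λ_i = Σ_{i' < i} λ_{i'}`).

* **`exists_lt_prefixSum`** — locating a point of `[0, Σλ)` in its piece.
* **`arc_repeat_of_D_inter_D`** — `|D_i ∩ D_j| ≥ g` (`i ≠ j`) forces two equal `g`-subwords of the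
  arc at distinct places.
* **`arc_invRepeat_of_D_inter_arc`** — `|D_i ∩ arc| ≥ g` forces a `g`-subword of the arc equal to
  the inverse of a `g`-subword of the arc.
* **`admissible_of_regular`** — the contrapositive package.
-/

noncomputable section

namespace Literature.GroupTheory.CombinatorialGroupTheory

section CombAdmissible

open Finset

open scoped Classical

/-- **Prefix sums partition `[0, Σ f)`.** [folklore] -/
theorem exists_lt_prefixSum (f : ℕ → ℕ) (m z : ℕ) (hz : z < ∑ i ∈ Finset.range m, f i) :
    ∃ i, i < m ∧ (∑ i' ∈ Finset.range i, f i') ≤ z ∧ z < (∑ i' ∈ Finset.range i, f i') + f i := by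
  induction m with
  | zero => simp at hz
  | succ m ih =>
    rw [Finset.sum_range_succ] at hz
    by_cases h : z < ∑ i ∈ Finset.range m, f i
    · obtain ⟨i, hi, h1, h2⟩ := ih h
      exact ⟨i, by omega, h1, h2⟩
    · exact ⟨m, by omega, by omega, hz⟩

/-- Prefix sums are monotone and dominate earlier pieces: `Σ_{<i} f + f i ≤ Σ_{<j} f` for
`i < j`. [folklore] -/
theorem prefixSum_add_le (f : ℕ → ℕ) {i j : ℕ} (hij : i < j) :
    (∑ i' ∈ Finset.range i, f i') + f i ≤ ∑ i' ∈ Finset.range j, f i' := by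
  rw [← Finset.sum_range_succ]
  exact Finset.sum_le_sum_of_subset (Finset.range_subset_range.mpr hij)

/-- **Two occurrence windows meeting in `≥ g` points give a repeated `g`-subword of the arc.**
If the `D`-constraints `vg (t_i + j) = vg (s + Λ_i + λ_i − 1 − j)⁻¹` hold for `i, j`-ranges, and
`D_i ∩ D_j` (`i ≠ j`) contains `g ≥ 1` consecutive points, then the arc `[s, s + Σλ)` contains two
equal subwords of length `g` starting at distinct offsets `x ≠ y`.
[cite: CalegariWalker2013, §4.6 (overlaps of `D_i` with `D_j` are `O(δ)`)] -/
theorem arc_repeat_of_D_inter_D {A : Type*} (inv : A → A) (hinv : ∀ a, inv (inv a) = a)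
    (vg : ℕ → A) (s m : ℕ) (t lam : ℕ → ℕ)
    (hD : ∀ i, i < m → ∀ j, j < lam i →
      vg (t i + j) = inv (vg (s + (∑ i' ∈ Finset.range i, lam i') + (lam i - 1 - j))))
    {i j : ℕ} (hi : i < m) (hj : j < m) (hij : i ≠ j) {g : ℕ} (hg : 1 ≤ g) {p₀ : ℕ}
    (hpi : t i ≤ p₀) (hpi' : p₀ + g ≤ t i + lam i) (hpj : t j ≤ p₀) (hpj' : p₀ + g ≤ t j + lam j) :
    ∃ x y, x ≠ y ∧ x + g ≤ ∑ i' ∈ Finset.range m, lam i' ∧ y + g ≤ ∑ i' ∈ Finset.range m, lam i' ∧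
      ∀ q, q < g → vg (s + x + q) = vg (s + y + q) := by
  set Pi := ∑ i' ∈ Finset.range i, lam i' with hPi
  set Pj := ∑ i' ∈ Finset.range j, lam i' with hPj
  refine ⟨Pi + (lam i + t i - p₀ - g), Pj + (lam j + t j - p₀ - g), ?_, ?_, ?_, ?_⟩
  · -- distinct: the pieces `[Pi, Pi + lam i)` and `[Pj, Pj + lam j)` are disjoint
    rcases Nat.lt_or_gt_of_ne hij with h | h
    · have := prefixSum_add_le lam h; omega
    · have := prefixSum_add_le lam h; omega
  · have := prefixSum_add_le lam hi; omega
  · have := prefixSum_add_le lam hj; omega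
  · intro q hq
    -- the point `p = p₀ + g - 1 - q ∈ D_i ∩ D_j`
    have h1 := hD i hi (p₀ + g - 1 - q - t i) (by omega)
    have h2 := hD j hj (p₀ + g - 1 - q - t j) (by omega)
    have e1 : t i + (p₀ + g - 1 - q - t i) = p₀ + g - 1 - q := by omega
    have e2 : t j + (p₀ + g - 1 - q - t j) = p₀ + g - 1 - q := by omega
    rw [e1] at h1
    rw [e2] at h2
    have e3 : s + Pi + (lam i - 1 - (p₀ + g - 1 - q - t i)) = s + (Pi + (lam i + t i - p₀ - g)) + q := by
      omega
    have e4 : s + Pj + (lam j - 1 - (p₀ + g - 1 - q - t j)) = s + (Pj + (lam j + t j - p₀ - g)) + q := by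
      omega
    rw [e3] at h1
    rw [e4] at h2
    have h3 : inv (vg (s + (Pi + (lam i + t i - p₀ - g)) + q)) =
        inv (vg (s + (Pj + (lam j + t j - p₀ - g)) + q)) := h1.symm.trans h2
    have h4 := congrArg inv h3
    rwa [hinv, hinv] at h4

/-- **An occurrence window meeting the arc in `≥ g` points gives an inverse repeat in the arc.**
[cite: CalegariWalker2013, §4.6 and Def. 4.11] -/
theorem arc_invRepeat_of_D_inter_arc {A : Type*} (inv : A → A)
    (vg : ℕ → A) (s m : ℕ) (t lam : ℕ → ℕ)
    (hD : ∀ i, i < m → ∀ j, j < lam i →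
      vg (t i + j) = inv (vg (s + (∑ i' ∈ Finset.range i, lam i') + (lam i - 1 - j))))
    {i : ℕ} (hi : i < m) {g : ℕ} {p₀ : ℕ}
    (hpi : t i ≤ p₀) (hpi' : p₀ + g ≤ t i + lam i) (hps : s ≤ p₀)
    (hps' : p₀ + g ≤ s + ∑ i' ∈ Finset.range m, lam i') :
    ∃ x y, x + g ≤ ∑ i' ∈ Finset.range m, lam i' ∧ y + g ≤ ∑ i' ∈ Finset.range m, lam i' ∧
      ∀ q, q < g → vg (s + x + q) = inv (vg (s + y + (g - 1 - q))) := by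
  set Pi := ∑ i' ∈ Finset.range i, lam i' with hPi
  refine ⟨p₀ - s, Pi + (lam i + t i - p₀ - g), by omega, ?_, ?_⟩
  · have := prefixSum_add_le lam hi; omega
  · intro q hq
    have h1 := hD i hi (p₀ + q - t i) (by omega)
    have e1 : t i + (p₀ + q - t i) = s + (p₀ - s) + q := by omega
    have e2 : s + Pi + (lam i - 1 - (p₀ + q - t i)) = s + (Pi + (lam i + t i - p₀ - g)) + (g - 1 - q) := by
      omega
    rw [e1, e2] at h1
    exact h1

/-- **Regularity forces admissibility.** If the `D`-constraints hold and the arc is `g`-regular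
(`g ≥ 1`): distinct offsets carry distinct `g`-subwords, and no `g`-subword of the arc is the
inverse of a `g`-subword of the arc — then `|D_i ∩ D_j| < g` for `i ≠ j` and `|D_i ∩ arc| < g`.
[cite: CalegariWalker2013, Def. 4.11 and §4.6] -/
theorem admissible_of_regular {A : Type*} (inv : A → A) (hinv : ∀ a, inv (inv a) = a)
    (vg : ℕ → A) (s m : ℕ) (t lam : ℕ → ℕ)
    (hD : ∀ i, i < m → ∀ j, j < lam i →
      vg (t i + j) = inv (vg (s + (∑ i' ∈ Finset.range i, lam i') + (lam i - 1 - j))))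
    {g : ℕ} (hg : 1 ≤ g)
    (hreg1 : ∀ x y, x ≠ y → x + g ≤ ∑ i' ∈ Finset.range m, lam i' →
      y + g ≤ ∑ i' ∈ Finset.range m, lam i' → ∃ q, q < g ∧ vg (s + x + q) ≠ vg (s + y + q))
    (hreg2 : ∀ x y, x + g ≤ ∑ i' ∈ Finset.range m, lam i' →
      y + g ≤ ∑ i' ∈ Finset.range m, lam i' →
        ∃ q, q < g ∧ vg (s + x + q) ≠ inv (vg (s + y + (g - 1 - q)))) :
    (∀ i j, i < m → j < m → i ≠ j →
      (Finset.Ico (t i) (t i + lam i) ∩ Finset.Ico (t j) (t j + lam j)).card < g) ∧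
    (∀ i, i < m →
      (Finset.Ico (t i) (t i + lam i) ∩ Finset.Ico s (s + ∑ i' ∈ Finset.range m, lam i')).card < g) := by
  constructor
  · intro i j hi hj hij
    by_contra hge
    rw [not_lt, Finset.Ico_inter_Ico, Nat.card_Ico] at hge
    obtain ⟨x, y, hxy, hx, hy, heq⟩ := arc_repeat_of_D_inter_D inv hinv vg s m t lam hD hi hj hij hg
      (p₀ := max (t i) (t j)) (le_max_left _ _) (by omega) (le_max_right _ _) (by omega)
    obtain ⟨q, hq, hne⟩ := hreg1 x y hxy hx hy
    exact hne (heq q hq)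
  · intro i hi
    by_contra hge
    rw [not_lt, Finset.Ico_inter_Ico, Nat.card_Ico] at hge
    obtain ⟨x, y, hx, hy, heq⟩ := arc_invRepeat_of_D_inter_arc inv vg s m t lam hD hi (g := g)
      (p₀ := max (t i) s) (le_max_left _ _) (by omega) (le_max_right _ _) (by omega)
    obtain ⟨q, hq, hne⟩ := hreg2 x y hx hy
    exact hne (heq q hq)

end CombAdmissible

end Literature.GroupTheory.CombinatorialGroupTheory

end
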